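import Summits.BirchSwinnertonDyer.BirchSwinnertonDyer.Theses.CongruentShaFreeCut
import Summits.BirchSwinnertonDyer.BirchSwinnertonDyer.Theorems.CongruentShaFreeCutRungSupersingular
import Literature.NumberTheory.EllipticCurves.BSDWave0ContinuationProofs
import Literature.NumberTheory.EllipticCurves.BSDInvariantsProofs
import Literature.NumberTheory.EllipticCurves.BSDQuadraticDescentShaOddPartGeneralProofs
import Literature.NumberTheory.EllipticCurves.LFunctionSmulProofs

/-! # Route `CongruentShaFreeCut` (rung S2) — crux `AnalyticRankOneOfRankOneFiniteShaTwo`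
(stmt-BirchSwinnertonDyer-19080): reduction to square-free `n`, and the crux with `Ш[2^∞]`
replaced by the WHOLE of `Ш` (decided in print modulo BKO 2024 Thm. 1.5)

Two support theorems for crux B = `rank E_n(ℚ) = 1 ∧ #Ш(E_n/ℚ)[2^∞] < ∞ ⟹ ord_{s=1} L(E_n,s) = 1`
(`E_n : y² = x³ − n²x`, every `n ≠ 0`), both pure logic over TREE THEOREMS plus, for the second,
ONE refereed named fact:

* `analyticRankOneOfRankOneFiniteShaTwo_of_squarefree` / `…_iff_squarefree`: it suffices to prove
  crux B for SQUARE-FREE `n`. Writing `n = b² a` with `a` square-free (`Nat.sq_mul_squarefree_of_pos`),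
  `E_n ≅ E_a` over `ℚ` by the change of variables `(x, y) ↦ (b²x, b³y)` (tree lemma
  `congruentNumberCurve_sq_mul`), and Mordell–Weil rank, finiteness of `Ш[p^∞]` and analytic rank
  are invariants of admissible changes of variables (tree theorems
  `mordellWeilRank_variableChange_holds`, `finite_primaryComponent_sha_variableChange`,
  `analyticRank_smul`; Silverman AEC III.3.1(b), X.§4, C.16). This is the form in which the
  `K`-level lines work (they need the GLOBALLY MINIMAL model, `isGloballyMinimal_congruentNumberCurve`,
  available exactly for square-free `n`).
* `analyticRank_eq_one_of_rank_eq_one_of_finite_sha_of_thm15` (**the Ш-finite converse with ALL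
  of `Ш` finite is decided in print**): for every `n ≠ 0`, `rank E_n(ℚ) = 1 ∧ #Ш(E_n/ℚ) < ∞ ⟹
  ord_{s=1} L(E_n, s) = 1`, granted Burungale–Kobayashi–Ota, JIMJ 23 (2024) Thm. 1.5 as printed
  (`hBKO`, tree fact `BurungaleKobayashiOta2024.thm15_analyticRank_eq_one_of_selmerCorank_eq_one`).
  Proof: reduce to `a` square-free; Dirichlet (Mathlib `Nat.forall_exists_prime_gt_and_eq_mod`)
  gives a prime `p ≡ 3 (mod 4)` with `p > max a 4`, so `p ≥ 5`, `p ∤ a`, `p` is a good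
  SUPERSINGULAR prime of `E_a` (`a_p = 0`); `Ш` finite gives `Ш[p^∞]` finite; the landed BC5 rung
  `CongruentShaFreeCutRungSupersingular.stub_rung_supersingular` (p410927) concludes.

WHAT THIS SAYS ABOUT THE CRUX (numbers, not adjectives). Crux B's hypothesis is finiteness of the
`2`-primary part ONLY. Every rank-one `p`-converse in refereed print consumes `corank_{ℤ_p}
Sel_{p^∞} = 1` AT ITS OWN PRIME `p` (equivalently `rank = 1 ∧ #Ш[p^∞] < ∞`, Greenberg's identity
`selmerCorank_eq_mordellWeilRank_add_holds`), and no theorem transfers finiteness of `Ш[2^∞]` to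
`Ш[p^∞]` for another `p` short of `ord_{s=1} L ≤ 1` itself. So with `Ш[2^∞]` alone the only usable
prime is `p = 2`, where `E_n` has ADDITIVE reduction (`2 ∣ N(E_n) = 32n²` or `16n²`): outside
BKO 2024 (inert `p ≥ 5`), Burungale–Tian 2020 (good ordinary `p > 3`), BCST 2022 / Burungale–Skinner
(good reduction). The second theorem records the exact distance: replace `Ш[2^∞]` by `Ш` (or by
`Ш[p^∞]` at ONE good supersingular `p ≥ 5`, which is the rung itself) and the statement is a tree
theorem modulo one refereed fact. Supports, does not close, stmt-BirchSwinnertonDyer-19080. -/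

namespace Summit.BirchSwinnertonDyer.BirchSwinnertonDyer.Theorems.CongruentShaFreeCutSquarefreeReduction

open Literature.NumberTheory.EllipticCurves WeierstrassCurve
open Summit.BirchSwinnertonDyer.BirchSwinnertonDyer.Theses.CongruentShaFreeCut

/-- **`E_n ≅ E_a` for `n = b² a`, read backwards**: the square-free model is a change of variables
of `E_n` (from the tree lemma `congruentNumberCurve_sq_mul`, Koblitz Ch. I §2). [folklore] -/
theorem exists_congruentNumberCurve_eq_smul_sq_mul (a : ℕ) {b : ℕ} (hb : b ≠ 0) :
    ∃ C : VariableChange ℚ, congruentNumberCurve a = C • congruentNumberCurve (b ^ 2 * a) := by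
  refine ⟨(⟨(Units.mk0 (b : ℚ) (by exact_mod_cast hb))⁻¹, 0, 0, 0⟩ : VariableChange ℚ)⁻¹, ?_⟩
  rw [congruentNumberCurve_sq_mul a hb, inv_smul_smul]

/-- **Transport of the crux data along a change of variables** (Silverman AEC III.3.1(b), X.§4,
C.16, as the tree theorems `mordellWeilRank_variableChange_holds`,
`finite_primaryComponent_sha_variableChange`, `analyticRank_smul`): if `W' = C • W` with `W`
elliptic, then `rank`, finiteness of `Ш[p^∞]` and the analytic rank agree on `W` and `W'`.
[cite: SilvermanAEC2009, III.3.1(b), X.§4, App. C §16] -/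
theorem analyticRank_eq_one_transport {W W' : WeierstrassCurve ℚ} [W.IsElliptic]
    {C : VariableChange ℚ} (e : W' = C • W) (p : ℕ)
    (h : W'.mordellWeilRank = 1 → Finite (AddCommGroup.primaryComponent W'.sha p) →
      W'.analyticRank = 1)
    (hrank : W.mordellWeilRank = 1) (hsha : Finite (AddCommGroup.primaryComponent W.sha p)) :
    W.analyticRank = 1 := by
  subst e
  haveI := hsha
  have hr : (C • W).mordellWeilRank = 1 := by
    have hmw : (C • W).mordellWeilRank = W.mordellWeilRank := mordellWeilRank_variableChange_holds W C
    rw [hmw, hrank]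
  have h1 := h hr (finite_primaryComponent_sha_variableChange W C p)
  rwa [analyticRank_smul] at h1

/-- **Crux B reduces to square-free `n`.** If `rank E_n(ℚ) = 1 ∧ #Ш(E_n/ℚ)[2^∞] < ∞ ⟹
ord_{s=1} L(E_n, s) = 1` holds for every SQUARE-FREE `n`, it holds for every `n ≠ 0`: write
`n = b² a`, `a` square-free; `E_a` is a change of variables of `E_n` and the three quantities are
invariants (`analyticRank_eq_one_transport`). [folklore] -/
theorem analyticRankOneOfRankOneFiniteShaTwo_of_squarefree
    (h : ∀ ⦃n : ℕ⦄, Squarefree n → (congruentNumberCurve n).mordellWeilRank = 1 →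
      Finite (AddCommGroup.primaryComponent (congruentNumberCurve n).sha 2) →
        (congruentNumberCurve n).analyticRank = 1) :
    AnalyticRankOneOfRankOneFiniteShaTwo := by
  intro n hn hrank hsha
  obtain ⟨a, b, -, hb, rfl, hsq⟩ := Nat.sq_mul_squarefree_of_pos (Nat.pos_of_ne_zero hn)
  haveI := isElliptic_congruentNumberCurve hn
  obtain ⟨C, e⟩ := exists_congruentNumberCurve_eq_smul_sq_mul a hb.ne'
  exact analyticRank_eq_one_transport e 2 (h hsq) hrank hsha

/-- **Crux B is EQUIVALENT to its square-free case** (the converse direction is the trivial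
specialisation `Squarefree n ⟹ n ≠ 0`). [folklore] -/
theorem analyticRankOneOfRankOneFiniteShaTwo_iff_squarefree :
    AnalyticRankOneOfRankOneFiniteShaTwo ↔
      ∀ ⦃n : ℕ⦄, Squarefree n → (congruentNumberCurve n).mordellWeilRank = 1 →
        Finite (AddCommGroup.primaryComponent (congruentNumberCurve n).sha 2) →
          (congruentNumberCurve n).analyticRank = 1 :=
  ⟨fun h _ hsq => h hsq.ne_zero, analyticRankOneOfRankOneFiniteShaTwo_of_squarefree⟩

/-- **`stub_squarefreeReduction`** of the alternative BC3 cut v2 of the crux (plan g9,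
`HOME/bsd-cn100-plan/routes-g9/bc/AnalyticRankOneOfRankOneFiniteShaTwo_birth_v2.lean`), with exactly
its registered-shape signature: the crux for square-free `n` implies the crux for every `n ≠ 0`
(`analyticRankOneOfRankOneFiniteShaTwo_of_squarefree`, unfolded). [folklore] -/
theorem stub_squarefreeReduction :
    (∀ ⦃n : ℕ⦄, Squarefree n → (congruentNumberCurve n).mordellWeilRank = 1 →
        Finite (AddCommGroup.primaryComponent (congruentNumberCurve n).sha 2) →
          (congruentNumberCurve n).analyticRank = 1) →
      ∀ ⦃n : ℕ⦄, n ≠ 0 → (congruentNumberCurve n).mordellWeilRank = 1 →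
        Finite (AddCommGroup.primaryComponent (congruentNumberCurve n).sha 2) →
          (congruentNumberCurve n).analyticRank = 1 :=
  fun h => analyticRankOneOfRankOneFiniteShaTwo_of_squarefree h

/-- **Dirichlet, for the supersingular primes of `E_a`**: for every `a ≠ 0` there is a prime
`p ≥ 5`, `p ≡ 3 (mod 4)`, `p ∤ a` (Mathlib's Dirichlet theorem
`Nat.forall_exists_prime_gt_and_eq_mod` for the unit `3 ∈ (ℤ/4)ˣ`, with `p > max a 4`). [folklore] -/
theorem exists_prime_five_le_mod_four_eq_three_not_dvd {a : ℕ} (ha : a ≠ 0) :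
    ∃ p : ℕ, p.Prime ∧ 5 ≤ p ∧ p % 4 = 3 ∧ ¬ p ∣ a := by
  have h3 : IsUnit (3 : ZMod 4) := by decide
  obtain ⟨p, hgt, hp, hp3⟩ := Nat.forall_exists_prime_gt_and_eq_mod h3 (max a 4)
  refine ⟨p, hp, by omega, ?_, ?_⟩
  · have hv := congrArg ZMod.val hp3
    rw [ZMod.val_natCast] at hv
    exact hv
  · exact Nat.not_dvd_of_pos_of_lt (Nat.pos_of_ne_zero ha) (by omega)

/-- **The Ш-finite converse for `E_n` with ALL of `Ш` finite is decided in print** (modulo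
Burungale–Kobayashi–Ota, JIMJ 23 (2024), Thm. 1.5 as the named tree fact `hBKO`): for every `n ≠ 0`,
`rank E_n(ℚ) = 1 ∧ #Ш(E_n/ℚ) < ∞ ⟹ ord_{s=1} L(E_n, s) = 1`. Reduce to `a` square-free
(`congruentNumberCurve_sq_mul`; `shaEquiv` transports finiteness of `Ш`, and rank / analytic rank
are invariants); pick a prime `p ≥ 5`, `p ≡ 3 (mod 4)`, `p ∤ a`
(`exists_prime_five_le_mod_four_eq_three_not_dvd`) — a good supersingular prime of `E_a`; `Ш`
finite gives `Ш[p^∞]` finite; conclude by the landed BC5 rung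
`CongruentShaFreeCutRungSupersingular.stub_rung_supersingular`. Compare crux B, whose hypothesis is
finiteness of `Ш[2^∞]` ALONE (`2` additive for `E_n`): the gap between the two statements is
exactly the finiteness of `Ш[p^∞]` at one good supersingular prime.
[cite: BurungaleKobayashiOta2023, Thm. 1.5 (JIMJ 23 (2024), p. 1422)] -/
theorem analyticRank_eq_one_of_rank_eq_one_of_finite_sha_of_thm15
    (hBKO : BurungaleKobayashiOta2024.thm15_analyticRank_eq_one_of_selmerCorank_eq_one)
    {n : ℕ} (hn : n ≠ 0) (hrank : (congruentNumberCurve n).mordellWeilRank = 1)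
    (hsha : Finite (congruentNumberCurve n).sha) :
    (congruentNumberCurve n).analyticRank = 1 := by
  obtain ⟨a, b, ha, hb, rfl, hsq⟩ := Nat.sq_mul_squarefree_of_pos (Nat.pos_of_ne_zero hn)
  haveI := isElliptic_congruentNumberCurve hn
  obtain ⟨C, e⟩ := exists_congruentNumberCurve_eq_smul_sq_mul a hb.ne'
  obtain ⟨p, hp, hp5, hp4, hpa⟩ := exists_prime_five_le_mod_four_eq_three_not_dvd ha.ne'
  haveI : Fact p.Prime := ⟨hp⟩
  refine analyticRank_eq_one_transport e p (fun hr _ => ?_) hrank inferInstance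
  -- on the square-free model `E_a = C • E_n`: `Ш(E_a)` is finite (transport along `shaEquiv`),
  -- hence so is `Ш(E_a)[p^∞]`, and the rung applies at the good supersingular prime `p`
  haveI : Finite (congruentNumberCurve a).sha := by
    rw [e]; exact Finite.of_equiv _ (shaEquiv (congruentNumberCurve (b ^ 2 * a)) C)
  exact CongruentShaFreeCutRungSupersingular.stub_rung_supersingular hBKO hsq hp5 hp4 hpa
    (e ▸ hr) inferInstance

end Summit.BirchSwinnertonDyer.BirchSwinnertonDyer.Theorems.CongruentShaFreeCutSquarefreeReduction
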